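import Literature.Computability.AlgebraicComplexity.HamiltonianCycleVNP
import Literature.Barriers.ValiantsHypothesis.GKKP11CharacteristicTwo
import HarnessLib

/-!
# The partial permanent is in `VNP` (every commutative ring) — the membership half behind
# Bürgisser's Problem 3.1 / GKKP 2011 §5, by Valiant's criterion

Bürgisser's partial permanent `per*(X) = Σ_π ∏_{i ∈ def π} X_{i π(i)}` (sum over the injective
partial maps `[n] ⇀ [n]`; Bürgisser 2000, Problem 3.1; Grenet–Kaltofen–Koiran–Portier 2011,
Def. 8 = the tree's `Matrix.partialPermanent` / family `partialPerPoly`,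
`GKKP11CharacteristicTwo.lean`) is the multilinear polynomial whose `0/1` coefficient function is
the indicator of the PARTIAL MATCHINGS of `K_{n,n}` (subsets of `[n] × [n]` with no two cells in a
row or a column). That indicator is BCS's recogniser `α_n(Y) = ∏ (1 − Y_p Y_q)` over the
conflicting pairs of cells (Bürgisser–Clausen–Shokrollahi 1997, proof of Prop. (21.15), where
`α_n β_n` recognises permutation matrices; dropping `β_n` — "every row is hit" — leaves exactly
the partial matchings), so Valiant's criterion (Bürgisser 2000, Prop. 2.20; BCS Prop. (21.15))
puts `(PER*_n)` in `VNP`: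

  `PER*_n(X) = Σ_{e ∈ {0,1}^{n×n}} α_n(e) · ∏_p (1 − e_p + e_p X_p)`   (`boolSum_ppWitness`),

the witness having `2n²` variables, degree `≤ 2n⁴ + 2n²` and complexity `≤ 4n⁴ + 5n² + 1`
(`isVPFamily_ppFamily`), whence **`isVNPFamily_partialPerPoly : IsVNPFamily (PER*_n)`**
(Bürgisser 2000, Def. 2.5 = the tree's `IsVNPFamily`), over every commutative ring. This is the
membership statement presupposed by the `VNP`-completeness question of Bürgisser's Problem 3.1
("is the partial permanent `VNP`-complete in characteristic 2?", GKKP 2011 §5, p0019:L5 and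
Cor. 1 / Thm. 9), complementing `PartialPermanentVPwsCharTwo.lean` (`PER* ∈ VP_ws` in
characteristic `2`, [Mal11]).

Reused, not restated: `conflictPairs` / `card_conflictPairs_le` and the cost lemmas of
`HamiltonianCycleVNP.lean` (BCS Prop. (21.15) for `HC`), `Matrix.partialPermanent`,
`partialPerPoly`. Definitions are the witness polynomials only (proof plumbing); no named facts.
Honest framing: a routine `VNP`-membership; `VP ≠ VNP` is NOT proved and nothing here bears on it.
Cell `val-lit`, seat t16 g5 (row GKKP11-B companion).

## References

* [Burgisser2000] P. Bürgisser, *Completeness and Reduction in Algebraic Complexity Theory*,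
  Springer 2000, Def. 2.5 (`VNP`), Prop. 2.20 (Valiant's criterion), Problem 3.1 (partial
  permanent).
* [BurgisserClausenShokrollahi1997] Bürgisser–Clausen–Shokrollahi, *Algebraic Complexity Theory*,
  Prop. (21.15) and its proof (the recogniser `α_n`), pp. 548–549.
* [GrenetEtAl2011] Grenet–Kaltofen–Koiran–Portier, arXiv:1007.3804, §5.2 Def. 8 (p0020), §5
  p0019:L5 (Bürgisser's Problem 3.1).
-/

noncomputable section

open MvPolynomial Equiv

universe u

namespace Literature.Barriers.ValiantsHypothesis

open Literature.Computability.AlgebraicComplexity Matrix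

namespace PartialPermanentVNP

/-! ### The recogniser of partial matchings -/

section Recogniser

variable {N : ℕ}

/-- The graph of a partial map `π : [N] ⇀ [N]` as a Boolean matrix, entry `(i, j)` being
`[π i = j]`. [cite: BurgisserClausenShokrollahi1997, Prop. (21.15) (proof)] -/
def partialGraph (π : Fin N → Option (Fin N)) : Fin N × Fin N → Bool :=
  fun p => decide (π p.1 = some p.2)

/-- A partial map is determined by its graph. [folklore] -/
private theorem partialGraph_injective : Function.Injective (partialGraph (N := N)) := by
  intro π π' h
  funext i
  rcases hi : π i with _ | j
  · rcases hi' : π' i with _ | j'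
    · rfl
    · have h1 := congrFun h (i, j')
      simp [partialGraph, hi, hi'] at h1
  · have h1 := congrFun h (i, j)
    simp only [partialGraph, hi, decide_true] at h1
    exact (of_decide_eq_true h1.symm).symm

/-- BCS's `α` at the graph of an injective partial map takes the value `1` (no two cells of the
graph share a row — `π` is a map — or a column — `π` is injective).
[cite: BurgisserClausenShokrollahi1997, Prop. (21.15) (proof, (A)–(B))] -/
private theorem alpha_partialGraph {R : Type*} [CommRing R] {π : Fin N → Option (Fin N)}
    (hπ : IsPartialInjective π) :
    (∏ pq ∈ conflictPairs N, (1 - (if partialGraph π pq.1 then (1 : R) else 0) *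
        (if partialGraph π pq.2 then (1 : R) else 0))) = 1 := by
  refine Finset.prod_eq_one ?_
  rintro ⟨p, q⟩ hpq
  simp only [conflictPairs, Finset.mem_filter, Finset.mem_univ, true_and] at hpq
  obtain ⟨hne, hrc⟩ := hpq
  have hnot : ¬ (partialGraph π p = true ∧ partialGraph π q = true) := by
    simp only [partialGraph, decide_eq_true_eq]
    rintro ⟨hp, hq⟩
    apply hne
    rcases hrc with h | h
    · refine Prod.ext h ?_
      rw [h] at hp
      exact Option.some_injective _ (hp.symm.trans hq)
    · exact Prod.ext (hπ _ _ _ hp (h ▸ hq)) h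
  by_cases hp : partialGraph π p = true
  · by_cases hq : partialGraph π q = true
    · exact absurd ⟨hp, hq⟩ hnot
    · simp [hq]
  · simp [hp]

/-- BCS's `α` vanishes at every Boolean matrix that is not the graph of an injective partial map
(such a matrix has two cells in a row or in a column).
[cite: BurgisserClausenShokrollahi1997, Prop. (21.15) (proof, (A)–(B))] -/
private theorem alpha_eq_zero {R : Type*} [CommRing R] {E : Fin N × Fin N → Bool}
    (hE : ∀ π : Fin N → Option (Fin N), IsPartialInjective π → partialGraph π ≠ E) :
    (∏ pq ∈ conflictPairs N, (1 - (if E pq.1 then (1 : R) else 0) *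
        (if E pq.2 then (1 : R) else 0))) = 0 := by
  classical
  by_cases h1 : ∃ pq ∈ conflictPairs N, E pq.1 = true ∧ E pq.2 = true
  · obtain ⟨pq, hpq, hp, hq⟩ := h1
    exact Finset.prod_eq_zero hpq (by simp [hp, hq])
  push Not at h1
  exfalso
  -- `E` is conflict-free: read it as the graph of the partial map `i ↦ the j with E (i, j)`
  have hrow : ∀ i j j', E (i, j) = true → E (i, j') = true → j = j' := by
    intro i j j' hj hj'
    by_contra hne
    have hmem : ((i, j), (i, j')) ∈ conflictPairs N :=
      Finset.mem_filter.2 ⟨Finset.mem_univ _, fun h => hne (Prod.ext_iff.1 h).2, Or.inl rfl⟩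
    exact h1 _ hmem hj hj'
  have hcol : ∀ i i' j, E (i, j) = true → E (i', j) = true → i = i' := by
    intro i i' j hi hi'
    by_contra hne
    have hmem : ((i, j), (i', j)) ∈ conflictPairs N :=
      Finset.mem_filter.2 ⟨Finset.mem_univ _, fun h => hne (Prod.ext_iff.1 h).1, Or.inr rfl⟩
    exact h1 _ hmem hi hi'
  obtain ⟨π, hπspec⟩ : ∃ π : Fin N → Option (Fin N), ∀ i j, π i = some j ↔ E (i, j) = true := by
    refine ⟨fun i => if h : ∃ j, E (i, j) = true then some h.choose else none, fun i j => ?_⟩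
    dsimp only
    constructor
    · intro hs
      by_cases h : ∃ j, E (i, j) = true
      · rw [dif_pos h] at hs
        have := h.choose_spec
        rwa [Option.some_injective _ hs] at this
      · rw [dif_neg h] at hs
        exact absurd hs (by simp)
    · intro hij
      have h : ∃ j, E (i, j) = true := ⟨j, hij⟩
      rw [dif_pos h]
      exact congrArg some (hrow i _ _ h.choose_spec hij)
  have hπgraph : partialGraph π = E := by
    funext ⟨i, j⟩
    simp only [partialGraph]
    by_cases hij : E (i, j) = true
    · rw [hij]
      exact decide_eq_true ((hπspec i j).2 hij)
    · rw [Bool.not_eq_true] at hij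
      rw [hij]
      exact decide_eq_false fun hs => by
        have := (hπspec i j).1 hs
        rw [hij] at this
        exact Bool.false_ne_true this
  have hπinj : IsPartialInjective π := fun a a' b ha ha' =>
    hcol _ _ _ ((hπspec a b).1 ha) ((hπspec a' b).1 ha')
  exact hE π hπinj hπgraph

/-- **Boolean sums against `α` are sums over partial matchings**: for any weight `G`,
`Σ_{E ∈ {0,1}^{N×N}} α(E) G(E) = Σ_{π injective partial map} G(graph π)`
(BCS 1997, proof of Prop. (21.15), (A), (B), (D), with `β` dropped).
[cite: BurgisserClausenShokrollahi1997, Prop. (21.15) (proof)] -/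
theorem sum_alpha_mul {R : Type*} [CommRing R] (G : (Fin N × Fin N → Bool) → R) :
    ∑ E : Fin N × Fin N → Bool,
      (∏ pq ∈ conflictPairs N, (1 - (if E pq.1 then (1 : R) else 0) *
          (if E pq.2 then (1 : R) else 0))) * G E =
      ∑ π ∈ (Finset.univ : Finset (Fin N → Option (Fin N))).filter (fun π => IsPartialInjective π),
        G (partialGraph π) := by
  classical
  have h : ∀ E : Fin N × Fin N → Bool,
      (∏ pq ∈ conflictPairs N, (1 - (if E pq.1 then (1 : R) else 0) *
          (if E pq.2 then (1 : R) else 0))) * G E =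
      if ∃ π, IsPartialInjective π ∧ partialGraph π = E then G E else 0 := by
    intro E
    split_ifs with hσ
    · obtain ⟨π, hπ, rfl⟩ := hσ
      rw [alpha_partialGraph hπ, one_mul]
    · push Not at hσ
      rw [alpha_eq_zero hσ, zero_mul]
  rw [Finset.sum_congr rfl fun E _ => h E, ← Finset.sum_filter]
  have hfi : (Finset.univ.filter fun E : Fin N × Fin N → Bool =>
      ∃ π, IsPartialInjective π ∧ partialGraph π = E) =
      ((Finset.univ : Finset (Fin N → Option (Fin N))).filter
        (fun π => IsPartialInjective π)).image partialGraph := by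
    ext E
    simp
  rw [hfi, Finset.sum_image fun π _ π' _ h => partialGraph_injective h]

end Recogniser

/-! ### The witness -/

section Witness

variable (N : ℕ) (k : Type u) [CommRing k]

/-- The variables of the witness: the `N²` matrix variables `X_p` (`Sum.inl p`) and `N²` Boolean
cell variables `Z_p = X (Sum.inr (finProdFinEquiv p))`, as `IsVNPFamily` requires.
[cite: Burgisser2000, Def. 2.5] -/
abbrev PPVars : Type := (Fin N × Fin N) ⊕ Fin (N * N)

/-- BCS's recogniser `α_N(Z) = ∏ (1 − Z_p Z_q)` over the conflicting pairs of cells: the indicator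
of partial matchings. [cite: BurgisserClausenShokrollahi1997, Prop. (21.15) (proof)] -/
def ppAlpha : MvPolynomial (PPVars N) k :=
  ∏ pq ∈ conflictPairs N,
    (1 - X (Sum.inr (finProdFinEquiv pq.1)) * X (Sum.inr (finProdFinEquiv pq.2)))

/-- The cover product `∏_p (1 − Z_p + Z_p X_p)`: at a Boolean point `e` it is the monomial
`∏_{p : e_p = 1} X_p`. [cite: Burgisser2000, Prop. 2.20 (proof)] -/
def ppCover : MvPolynomial (PPVars N) k :=
  ∏ p : Fin N × Fin N,
    (1 - X (Sum.inr (finProdFinEquiv p)) + X (Sum.inr (finProdFinEquiv p)) * X (Sum.inl p))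

/-- The `VNP` witness `G_N(X, Z) = α_N(Z) · ∏_p (1 − Z_p + Z_p X_p)` of `PER*_N`.
[cite: Burgisser2000, Prop. 2.20 (proof)] -/
def ppWitness : MvPolynomial (PPVars N) k := ppAlpha N k * ppCover N k

/-- **`PER*_N` is the Boolean sum of the witness**:
`Σ_{e ∈ {0,1}^{N×N}} G_N(X, e) = Σ_{π injective partial} ∏_{i ∈ def π} X_{i π(i)} = PER*_N(X)`.
[cite: Burgisser2000, Prop. 2.20] -/
theorem boolSum_ppWitness : boolSum (ppWitness N k) = partialPerPoly (Fin N) k := by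
  classical
  unfold boolSum ppWitness ppAlpha ppCover
  simp only [map_mul, map_prod, map_sub, map_add, map_one, aeval_X, Sum.elim_inl, Sum.elim_inr]
  rw [← Equiv.sum_comp (Equiv.arrowCongr finProdFinEquiv (Equiv.refl Bool))]
  simp only [Equiv.arrowCongr_apply, Equiv.coe_refl, Function.comp_apply, id_eq,
    Equiv.symm_apply_apply]
  -- the cover factor at a Boolean point
  have hcov : ∀ E : Fin N × Fin N → Bool, (∏ p : Fin N × Fin N,
      (1 - (if E p = true then (1 : MvPolynomial (Fin N × Fin N) k) else 0) +
        (if E p = true then (1 : MvPolynomial (Fin N × Fin N) k) else 0) * X p)) =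
      ∏ p : Fin N × Fin N, (if E p = true then X p else 1) := by
    intro E
    refine Finset.prod_congr rfl fun p _ => ?_
    split_ifs <;> simp
  simp_rw [hcov]
  refine (sum_alpha_mul _).trans ?_
  rw [partialPerPoly_def, Matrix.partialPermanent]
  -- (the two `filter`s carry different `Decidable` instances: compare memberships)
  refine Finset.sum_congr (by ext π; simp only [Finset.mem_filter]) fun π _ => ?_
  rw [Fintype.prod_prod_type]
  refine Finset.prod_congr rfl fun i _ => ?_
  rcases hi : π i with _ | j
  · simp [partialGraph, hi]
  · simp only [partialGraph, hi, Option.some.injEq, decide_eq_true_eq, Option.elim_some]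
    rw [Finset.prod_eq_single j (fun j' _ hj' => if_neg (Ne.symm hj')) (by simp)]
    simp [Matrix.mvPolynomialX_apply]

/-! ### Size of the witness -/

/-- `deg α_N ≤ 2 N⁴`. [cite: BurgisserClausenShokrollahi1997, Prop. (21.15)] -/
theorem totalDegree_ppAlpha_le : (ppAlpha N k).totalDegree ≤ N ^ 4 * 2 := by
  unfold ppAlpha
  refine (totalDegree_prod_le_of_le _ _ 2 fun pq _ => totalDegree_one_sub_X_mul_X_le _ _).trans ?_
  exact Nat.mul_le_mul_right 2 (card_conflictPairs_le N)

/-- The degree of a cover factor `1 − Z + Z X` is at most `2`. [folklore] -/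
private theorem totalDegree_coverFactor_le (p : Fin N × Fin N) :
    (1 - X (Sum.inr (finProdFinEquiv p)) + X (Sum.inr (finProdFinEquiv p)) * X (Sum.inl p) :
      MvPolynomial (PPVars N) k).totalDegree ≤ 2 := by
  refine (totalDegree_add _ _).trans (max_le ?_ ?_)
  · refine (totalDegree_sub _ _).trans (max_le ?_ ?_)
    · rw [totalDegree_one]; exact Nat.zero_le _
    · exact (totalDegree_X_le_one _).trans (by norm_num)
  · exact (totalDegree_mul _ _).trans (add_le_add (totalDegree_X_le_one _) (totalDegree_X_le_one _))

/-- `deg (cover) ≤ 2 N²`. [cite: Burgisser2000, Prop. 2.20 (proof)] -/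
theorem totalDegree_ppCover_le : (ppCover N k).totalDegree ≤ N * N * 2 := by
  unfold ppCover
  refine (totalDegree_prod_le_of_le _ _ 2 fun p _ => totalDegree_coverFactor_le N k p).trans ?_
  simp [Finset.card_univ, Fintype.card_prod, Fintype.card_fin]

/-- `deg G_N ≤ 2 N⁴ + 2 N²`. [cite: Burgisser2000, Prop. 2.20 (proof)] -/
theorem totalDegree_ppWitness_le : (ppWitness N k).totalDegree ≤ N ^ 4 * 2 + N * N * 2 :=
  (totalDegree_mul _ _).trans (add_le_add (totalDegree_ppAlpha_le N k) (totalDegree_ppCover_le N k))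

/-- `L(α_N) ≤ 4 N⁴`. [cite: BurgisserClausenShokrollahi1997, Prop. (21.15)] -/
theorem complexity_ppAlpha_le : complexity (ppAlpha N k) ≤ N ^ 4 * 3 + N ^ 4 := by
  unfold ppAlpha
  refine (complexity_prod_le_of_le _ _ _ fun pq _ => complexity_one_sub_X_mul_X_le _ _).trans ?_
  have h := card_conflictPairs_le N
  gcongr

/-- `L(1 − Z + Z X) ≤ 4` (`1 − Z = 1 + (−1)·Z`; BCS Def. (21.3), inputs and constants free).
[cite: BurgisserClausenShokrollahi1997, Def. (21.3)] -/
private theorem complexity_coverFactor_le (p : Fin N × Fin N) :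
    complexity (1 - X (Sum.inr (finProdFinEquiv p)) + X (Sum.inr (finProdFinEquiv p)) * X (Sum.inl p) :
      MvPolynomial (PPVars N) k) ≤ 4 := by
  have he : (1 - X (Sum.inr (finProdFinEquiv p)) : MvPolynomial (PPVars N) k) =
      C 1 + C (-1) * X (Sum.inr (finProdFinEquiv p)) := by
    rw [map_neg, map_one, neg_one_mul, sub_eq_add_neg]
  rw [he]
  have h1 := complexity_add_le_holds (C 1 + C (-1) * X (Sum.inr (finProdFinEquiv p)) :
    MvPolynomial (PPVars N) k) (X (Sum.inr (finProdFinEquiv p)) * X (Sum.inl p))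
  have h2 := complexity_add_le_holds (C 1 : MvPolynomial (PPVars N) k)
    (C (-1) * X (Sum.inr (finProdFinEquiv p)))
  have h3 := complexity_mul_le_holds (C (-1) : MvPolynomial (PPVars N) k)
    (X (Sum.inr (finProdFinEquiv p)))
  have h4 := complexity_mul_le_holds (X (Sum.inr (finProdFinEquiv p)) : MvPolynomial (PPVars N) k)
    (X (Sum.inl p))
  have h5 := complexity_C_holds (σ := PPVars N) (1 : k)
  have h6 := complexity_C_holds (σ := PPVars N) (-1 : k)
  have h7 := complexity_X_holds (k := k) (Sum.inr (finProdFinEquiv p) : PPVars N)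
  have h8 := complexity_X_holds (k := k) (Sum.inl p : PPVars N)
  omega

/-- `L(cover) ≤ 5 N²`. [cite: Burgisser2000, Prop. 2.20 (proof)] -/
theorem complexity_ppCover_le : complexity (ppCover N k) ≤ N * N * 4 + N * N := by
  unfold ppCover
  refine (complexity_prod_le_of_le _ _ _ fun p _ => complexity_coverFactor_le N k p).trans ?_
  simp [Finset.card_univ, Fintype.card_prod, Fintype.card_fin]

/-- `L(G_N) ≤ 4 N⁴ + 5 N² + 1`. [cite: Burgisser2000, Prop. 2.20 (proof)] -/
theorem complexity_ppWitness_le :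
    complexity (ppWitness N k) ≤ (N ^ 4 * 3 + N ^ 4) + (N * N * 4 + N * N) + 1 := by
  unfold ppWitness
  exact (complexity_mul_le_holds _ _).trans
    (Nat.add_le_add_right (add_le_add (complexity_ppAlpha_le N k) (complexity_ppCover_le N k)) 1)

end Witness

/-! ### `PER*` is a p-family and is in `VNP` -/

section Family

variable (k : Type u) [CommRing k]

/-- `deg PER*_n ≤ n`: each term `∏_{i ∈ def π} X_{i π(i)}` has at most one variable per row.
[cite: GrenetEtAl2011, Def 8] -/
theorem totalDegree_partialPerPoly_le (n : ℕ) : (partialPerPoly (Fin n) k).totalDegree ≤ n := by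
  rw [partialPerPoly_def, Matrix.partialPermanent]
  refine totalDegree_sum_le_of_le _ _ n fun π _ => ?_
  refine (totalDegree_prod_le_of_le _ _ 1 fun i _ => ?_).trans (by simp)
  rcases hi : π i with _ | j
  · simp
  · simpa [Matrix.mvPolynomialX_apply] using totalDegree_X_le_one (σ := Fin n × Fin n) (k := k) (i, j)

/-- **`(PER*_n)` is a p-family**: `n²` variables, degree `≤ n`. [cite: Burgisser2000, Def. 2.3] -/
theorem isPFamily_partialPerPoly : IsPFamily fun n => partialPerPoly (Fin n) k := by
  refine ⟨(IsPBounded.mul_holds IsPBounded.id IsPBounded.id).mono fun n => by simp,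
    IsPBounded.id.mono fun n => totalDegree_partialPerPoly_le k n⟩

/-- The `VNP` witness family `n ↦ G_n`. [cite: Burgisser2000, Prop. 2.20 (proof)] -/
def ppFamily : ∀ n : ℕ, MvPolynomial ((Fin n × Fin n) ⊕ Fin (n * n)) k := fun n => ppWitness n k

/-- **The witness family is in `VP`**: `2n²` variables, degree `≤ 2n⁴ + 2n²`, complexity
`≤ 4n⁴ + 5n² + 1`. [cite: Burgisser2000, Prop. 2.20 (proof)] -/
theorem isVPFamily_ppFamily : IsVPFamily (ppFamily k) := by
  refine ⟨⟨(IsPBounded.iff_exists_le_mul_succ_pow _).2 ⟨2, 2, fun n => ?_⟩,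
    (IsPBounded.iff_exists_le_mul_succ_pow _).2 ⟨4, 4, fun n => ?_⟩⟩,
    (IsPBounded.iff_exists_le_mul_succ_pow _).2 ⟨10, 4, fun n => ?_⟩⟩
  · simp only [Fintype.card_sum, Fintype.card_prod, Fintype.card_fin]
    nlinarith
  · refine (totalDegree_ppWitness_le n k).trans ?_
    have h1 : n ^ 4 ≤ (n + 1) ^ 4 := Nat.pow_le_pow_left (Nat.le_succ _) 4
    have h2 : n * n ≤ (n + 1) ^ 4 := by
      calc n * n = n ^ 2 := (sq n).symm
        _ ≤ (n + 1) ^ 2 := Nat.pow_le_pow_left (Nat.le_succ _) 2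
        _ ≤ (n + 1) ^ 4 := Nat.pow_le_pow_right (Nat.succ_pos _) (by norm_num)
    omega
  · refine (complexity_ppWitness_le n k).trans ?_
    have h1 : n ^ 4 ≤ (n + 1) ^ 4 := Nat.pow_le_pow_left (Nat.le_succ _) 4
    have h2 : n * n ≤ (n + 1) ^ 4 := by
      calc n * n = n ^ 2 := (sq n).symm
        _ ≤ (n + 1) ^ 2 := Nat.pow_le_pow_left (Nat.le_succ _) 2
        _ ≤ (n + 1) ^ 4 := Nat.pow_le_pow_right (Nat.succ_pos _) (by norm_num)
    have h3 : 1 ≤ (n + 1) ^ 4 := Nat.one_le_pow _ _ (Nat.succ_pos _)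
    omega

end Family

end PartialPermanentVNP

open PartialPermanentVNP in
/-- **`PER* ∈ VNP` over every commutative ring** (Bürgisser 2000, Def. 2.5, by Valiant's
criterion Prop. 2.20 / BCS Prop. (21.15): the coefficient function of the multilinear `PER*_n` is
the indicator of partial matchings, recognised by `α_n`): witness `ppFamily`, Boolean sum of
length `n²`. The membership half of Bürgisser's Problem 3.1 ("is `PER*` `VNP`-complete in
characteristic 2?", GKKP 2011 §5, p0019:L5), obtained here by APPLYING Valiant's criterion to
GKKP's Def. 8 — the sources state the completeness question, the membership is the routine half.
[cite: Burgisser2000, Prop. 2.20 (Valiant's criterion), Def. 2.5; applied to GrenetEtAl2011, Def 8 (cf. Problem 3.1)] -/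
theorem isVNPFamily_partialPerPoly (k : Type u) [CommRing k] :
    IsVNPFamily fun n => partialPerPoly (Fin n) k :=
  ⟨isPFamily_partialPerPoly k, fun n => n * n, ppFamily k, isVPFamily_ppFamily k,
    fun n => (boolSum_ppWitness n k).symm⟩

end Literature.Barriers.ValiantsHypothesis

end
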